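import Literature.MathematicalPhysics.QuantumFieldTheory.Balaban1983to89.B10Assembly
import Literature.MathematicalPhysics.QuantumFieldTheory.Balaban1983to89.B10Eq59Localization
import Literature.MathematicalPhysics.QuantumFieldTheory.Balaban1983to89.TreeLengthTorus

/-!
# Bałaban CMP 102 (1985) 255–275, d = 3 lattice UV stability AS PRINTED — prover seat p6 (lane `pub-balaban3d`):
# the whole-lattice vacuum sum from (25) (p. 270 / p. 265) and the remainder booking of (41) — the step leaves
# `VacuumWhole`, `RmSucc` of `B10SectAGathering.StepLeaves`, CARRIER-PARAMETRIC (any `T : B10.TowerRun`, any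
# `P : StepPieces T k`); sibling of `…Balaban3D.Representation33` (`Repr33_60`, `Decomp35_61`)

Source: T. Bałaban, *Ultraviolet stability of three-dimensional lattice pure gauge field theories*, Commun. Math.
Phys. **102** (1985) 255–275, doi:10.1007/bf01229380 [Balaban1985UV3] (= [B10]; held as
`paper:balaban1985-cmp102-uv-stability-3d`; journal page = PDF page + 254).  Quotations read on the page RENDERS
`run/shared/lean/pub/pub-balaban/b2b-balaban-ref1/pages/1985-cmp102-uv-stability-3d/…-p008/p011/p012/p016-x2.png`
(pp. 262, 265, 266, 270) as images; `p. N Lnn` = journal page N, line nn of the text-layer file `p00(N−254).txt`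
of `lit read` (its L1 is the running head; the lane PLAN §1 convention).

HONEST FRAMING (lane PLAN.md §0, binding).  [B10] proves UV stability of the d = 3 Wilson lattice gauge theory on a
finite torus — NOT a continuum limit, NOT infinite volume, NOT a mass gap, NOT d = 4, NOT the Millennium problem.
This file asserts NO sentence of the paper: every printed input is an explicit hypothesis of a theorem, and every
`theorem` is [folklore] arithmetic or the composition of kernel-checked LQB theorems its docstring names.  LQB =
`Literature.MathematicalPhysics.QuantumFieldTheory.Balaban1983to89.*`, imported BY NAME: `B10.TowerRun`,
`B10.Bound25Printed`, `B10SectAGathering.StepPieces/VacuumWhole/RmSucc`, `B10Assembly.VacuumWholeRaw/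
vacuumWhole_of_raw/rawConstR/rmSucc_of_booking`, `B10Eq59Localization.vacuumWholeRaw_shape_exp_neg_R`,
`B12TreeDecay.CubeSystem/kappa₀/K₀`, `Setup.LocDomainSys`.

WHAT THE PAPER PRINTS HERE.  p. 270 L29–33: «We get a sum of terms, each having a localization domain X. Terms with
localization domains X having non-empty intersections with Ω^c_{k+1} are estimated by O(g_k)|Z_k|. Terms with
domains X, which are not contained in a cube of the size R(g_k)M₁, are estimated by O((L^kε)^{3+κ₀})|T₁^{(k)}|. The
remaining terms give the sum (59) Σ_X 𝒫′_{k+1}(g_k, X, U_{k+1}) over localizations X ⊂ Ω_{k+1}, … The terms 𝒫′_{k+1}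
satisfy the bound (25)»; k = 0, p. 265 L2–4: «To obtain the whole counterterm we have to add a sum of the
corresponding terms with localizations X satisfying X ∩ Ω₁ᶜ ≠ ∅. This sum can be bounded by O(g₀)|Ω₁ᶜ|.»; (25)
p. 262: «|𝒫′₁(g₀, X, U₁)| ≤ O(g₀) exp(−κ𝓛(X)), where κ can be arbitrarily large if M₁ is sufficiently large»; (41)
p. 266: «+ Σ_{j=0}^{k−1} O((Lʲε)^{3+κ₀})|T₁^{(j)}|».

THE READING KERNEL-CHECKED HERE.  The vacuum leaf is LQB's one-scale derivation from (25) over the cube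
carriers (`B10Eq59Localization`) composed with `vacuumWhole_of_raw` (one power `g_k ≤ 1` given away to make the
large-localization constant k-free); `vacuumWhole_torus` is the same on LQB's 3-torus block carrier
(`TreeLengthTorus.tsys/tcubeSys 3 N`, the carrier the lane's cumulant leaves use), and `sum_le_of_bound25` is (25)
summed over any finite family of domains (the input `sumM_le` of the sibling's `ChartExpansion`).  `RmSucc` is the
booking identity for a run whose remainder coefficient is a partial sum, `Rm k = c·Σ_{j<k} rem_j` (constant
coefficient, `rmSucc_of_partialSum`) or `Rm k = Σ_{j<k} r_j` (per-step coefficients as in the spine's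
`Balaban1985CMP102.SectB.TowerObjects.Rm`, `rmSucc_of_sum_booking`).  `Norm35` needs nothing here: LQB
`B10Eq35Norm.norm35_of_model` / the lane binder `Balaban1985CMP102.Binders.Norm35StepAsCited.norm35`.

HYPOTHESES AND THEIR STATUS.  Printed displays of [B10]: (25) at g = g_k (`B10.Bound25Printed`; the cumulant seat
p5's output), (59) (the identification hypotheses `hPprT`/`hPpr1`), (39)/(7) R(g_k) = R₁r(g_k).  Series/model
binders: the cube carriers of `B12TreeDecay` (wall degree ≤ Δ, volume leaf c₀ — cell GAPS G-IF-04-type locality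
inputs), `|Z_k| ≥` the number of big blocks outside Ω_{k+1} and `#blocks ≤ |T₁^{(k)}|` (unit-lattice counts).  NOT
IN PRINT (located by the LQB power counting, cell GAPS G-B10-02 / SMALLNESS S-B10.9): r₀ ≥ 1, R₁ ≥ 6 + 2κ₀, κ₀ > 0,
κ ≥ κ₀(c₀, Δ) + 1.  WHAT IS NOT HERE: any construction of 𝒫′ or of `run3`; the large-field side; `Norm35` (LQB
`B10Eq35Norm.norm35_of_model`).  PLACEMENT: lane cell topic `Summits/QuantumFields/Balaban3D/Proofs/` (PLAN §3.0
R-PATH).  Record: HOME `run/shared/lean/pub/pub-balaban3d/` (STATUS lines [p6]).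
-/

noncomputable section

open scoped Topology Nat
open Metric Set Finset
open Literature.MathematicalPhysics.QuantumFieldTheory.Balaban1983to89
open Literature.MathematicalPhysics.QuantumFieldTheory.Balaban1983to89.B10
open Literature.MathematicalPhysics.QuantumFieldTheory.Balaban1983to89.B10SectAGathering
open Literature.MathematicalPhysics.QuantumFieldTheory.Balaban1983to89.B10Assembly

namespace Summit.QuantumFields.Balaban3D.Proofs.VacuumAndBooking

/-! ## §1 The whole-lattice vacuum sum from (25): `VacuumWhole` via `B10Eq59Localization` -/

section Vacuum

open Literature.MathematicalPhysics.QuantumFieldTheory.Balaban1983to89.B12TreeDecay (CubeSystem kappa₀ K₀ K₀_pos)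

variable {T : TowerRun} {k : ℕ}

/-- Elementary: `0 ≤ r(g) = (1 + log g⁻¹)^{r₀}` for `0 < g ≤ 1` (`B10.rFun`). [folklore] -/
theorem rFun_nonneg (r₀ g : ℝ) (hg : 0 < g) (hg1 : g ≤ 1) : 0 ≤ rFun r₀ g := by
  have := log_inv_nonneg_of_le_one hg hg1
  unfold rFun
  exact Real.rpow_nonneg (by linarith) _

/-- **(25) summed over ANY family of localizations** (p. 264 L23–25 «We use the remaining exp(−κ₁𝓛(X)) to control
a sum over all X contributing to a given monomial in variables B»; the input `sumM_le`/`CM` of the sibling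
`…Balaban3D.Representation33.ChartExpansion`): nonnegative per-domain bounds `M X ≤ C·g·e^{−κ𝓛(X)}` over the cube
carriers of `B12TreeDecay` (wall degree ≤ Δ, volume leaf c₀, κ ≥ κ₀(c₀, Δ)) sum to `≤ (C·g·K₀(c₀, Δ))·#blocks` over
every finite family — LQB `B10Eq59Localization.sum_exp_large_le` at threshold `R = 0` (all domains, `𝓛 ≥ 0`).  With
`g = g_k ≤ 1` the chart constant is `CM := C·K₀(c₀, Δ)`, `vol := #blocks`. [cite: Balaban1985UV3, (25) p.262 + p.264] -/
theorem sum_le_of_bound25 {S : LocDomainSys} (G : CubeSystem S) {Δ : ℕ} {c₀ κ C g : ℝ} (hΔ : G.DegreeLE Δ)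
    (hV : G.VolumeLeaf c₀) (hκ : kappa₀ c₀ Δ ≤ κ) (hCg : 0 ≤ C * g) (M : S.Dom → ℝ) (hM0 : ∀ X, 0 ≤ M X)
    (hM : ∀ X, M X ≤ C * g * Real.exp (-κ * S.dj X)) (loc : Finset S.Dom) :
    ∑ X ∈ loc, M X ≤ (C * g * K₀ c₀ Δ) * Fintype.card G.Cube := by
  classical
  have hall : (Finset.univ.filter fun X : S.Dom => (0 : ℝ) ≤ S.dj X) = Finset.univ :=
    Finset.filter_true_of_mem fun X _ => S.dj_nonneg X
  have hlarge := B10Eq59Localization.sum_exp_large_le G hΔ hV hκ 0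
  rw [hall, mul_zero, Real.exp_zero, one_mul] at hlarge
  calc ∑ X ∈ loc, M X ≤ ∑ X : S.Dom, M X :=
        Finset.sum_le_sum_of_subset_of_nonneg (Finset.subset_univ _) fun X _ _ => hM0 X
    _ ≤ ∑ X : S.Dom, C * g * Real.exp (-κ * S.dj X) := Finset.sum_le_sum fun X _ => hM X
    _ = C * g * ∑ X : S.Dom, Real.exp (-κ * S.dj X) := by rw [Finset.mul_sum]
    _ ≤ C * g * (K₀ c₀ Δ * Fintype.card G.Cube) := mul_le_mul_of_nonneg_left hlarge hCg
    _ = (C * g * K₀ c₀ Δ) * Fintype.card G.Cube := by ring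

/-- **Leaf `VacuumWhole` of `B10SectAGathering.StepLeaves` from (25) over the cube carriers** — the TYPE is literally
the leaf.  Printed: p. 270 L30–33 «Terms with localization domains X having non-empty intersections with Ω^c_{k+1}
are estimated by O(g_k)|Z_k|. Terms with domains X, which are not contained in a cube of the size R(g_k)M₁, are
estimated by O((L^kε)^{3+κ₀})|T₁^{(k)}|» (k = 0: p. 265 L2–4 «we have to add a sum of the corresponding terms with
localizations X satisfying X ∩ Ω₁ᶜ ≠ ∅. This sum can be bounded by O(g₀)|Ω₁ᶜ|»), from **(25)** p. 262 at `g = g_k`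
over a system of localization domains with tree length 𝓛 (`Setup.LocDomainSys`) and big blocks
(`B12TreeDecay.CubeSystem`; wall degree ≤ Δ, volume leaf c₀, κ ≥ κ₀(c₀, Δ) + 1 = «κ can be arbitrarily large if M₁
is sufficiently large», p. 262).  IF `PprT` = the sum over ALL localizations at U_{k+1} = 1 (the whole counterterm
of (62)), `Ppr1 h` = the retained sum (59) (X inside Ω_{k+1}(h) and 𝓛(X) < R₁r(g_k) = R(g_k), (39) p. 266), `|Z_k|`
dominates the number of blocks outside Ω_{k+1}(h), and the number of blocks is `≤ |T₁^{(k)}|`, THEN `VacuumWhole P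
(C·K₀(c₀,Δ)) (rawConstR (C·K₀(c₀,Δ)) R₁ g κ₀)` — LQB `B10Eq59Localization.vacuumWholeRaw_shape_exp_neg_R` (one
scale) composed with `B10Assembly.vacuumWhole_of_raw` (the `exp(−R) ↦ O((L^kε)^{3+κ₀})` arithmetic; r₀ ≥ 1,
R₁ ≥ 6 + 2κ₀, κ₀ > 0 are its located side conditions), one factor `g_k ≤ 1` given away so that the
large-localization constant is k-free. [cite: Balaban1985UV3, (59) p.270 + (25) p.262 + p.265] -/
theorem vacuumWhole_of_bound25 (P : StepPieces T k) {S : LocDomainSys} (G : CubeSystem S) {Δ : ℕ}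
    {c₀ κ C : ℝ} {Cfg : Type} (hΔ : G.DegreeLE Δ) (hV : G.VolumeLeaf c₀) (hκ : kappa₀ c₀ Δ + 1 ≤ κ)
    (act : S.Dom → Cfg → ℝ) (one : Cfg) (hC : 0 ≤ C)
    (h25 : Bound25Printed ⟨S.Dom, Cfg, S.dj, act⟩ (T.g k) κ C)
    (Ω : T.Hist (k + 1) → Finset G.Cube)
    (g L ε κ₀ r₀ R₁ : ℝ) (hg : 0 < g) (hL : 0 < L) (hε : 0 < ε) (hκ₀ : 0 < κ₀) (hr₀ : 1 ≤ r₀)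
    (hR₁ : 6 + 2 * κ₀ ≤ R₁) (hgk : T.g k = gRun g L ε k) (hgk1 : T.g k ≤ 1)
    (hrem : P.rem = (L ^ k * ε) ^ (3 + κ₀) * T.sites k)
    (hPprT : P.PprT = ∑ X : S.Dom, act X one)
    (hPpr1 : ∀ h, P.Ppr1 h = ∑ X ∈ (Finset.univ.filter (fun X : S.Dom => G.cubes X ⊆ Ω h)).filter
        (fun X => S.dj X < R₁ * rFun r₀ (T.g k)), act X one)
    (hZ : ∀ h, ((Finset.univ \ Ω h).card : ℝ) ≤ P.Zvol h)
    (hcard : (Fintype.card G.Cube : ℝ) ≤ T.sites k) :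
    VacuumWhole P (C * K₀ c₀ Δ) (rawConstR (C * K₀ c₀ Δ) R₁ g κ₀) := by
  have hgpos : 0 < T.g k := by rw [hgk]; exact gRun_pos g L ε hg hL hε k
  have hCg : 0 ≤ C * T.g k := mul_nonneg hC hgpos.le
  have hK : 0 < K₀ c₀ Δ := K₀_pos c₀ Δ
  have hR : 0 ≤ R₁ * rFun r₀ (T.g k) :=
    mul_nonneg (by linarith) (rFun_nonneg r₀ (T.g k) hgpos hgk1)
  have hraw : VacuumWholeRaw P (C * K₀ c₀ Δ) (C * K₀ c₀ Δ) r₀ R₁ (fun _ => (Fintype.card G.Cube : ℝ)) := by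
    intro h
    have hs := B10Eq59Localization.vacuumWholeRaw_shape_exp_neg_R G hΔ hV hκ act hCg h25 one (Ω h) hR (hZ h)
    rw [hPprT, hPpr1 h]
    refine hs.trans ?_
    have hcardnn : (0 : ℝ) ≤ Fintype.card G.Cube := Nat.cast_nonneg _
    have hdrop : C * T.g k * K₀ c₀ Δ * Fintype.card G.Cube ≤ C * K₀ c₀ Δ * Fintype.card G.Cube := by
      have : C * T.g k ≤ C := by nlinarith
      nlinarith [mul_nonneg (mul_nonneg hC hK.le) hcardnn]
    have hexp : 0 ≤ Real.exp (-(R₁ * rFun r₀ (T.g k))) := Real.exp_nonneg _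
    nlinarith [mul_le_mul_of_nonneg_right hdrop hexp]
  exact vacuumWhole_of_raw P g L ε κ₀ hg hL hε hκ₀ hr₀ hR₁ (mul_nonneg hC hK.le) hgk hgk1
    (fun _ => Nat.cast_nonneg _) (fun _ => hcard) hrem hraw


/-- **`VacuumWhole` on LQB's 3-torus block carrier** (`TreeLengthTorus.tsys 3 N` / `tcubeSys 3 N`: `N` big blocks per
direction at scale k, wall degree ≤ 6, volume leaf 32 = 4·2³, `N³` blocks — the same carrier prover seat p5 uses for
`Cumulant58`/`PprT_le`, so that the lane instantiates ONE system per scale): (25) at `g_k` with `κ ≥ κ₀(32, 6) + 1`,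
`PprT = Σ_X 𝒫′(X, 1)`, `Ppr1 h` = the retained sum, `#(blocks ∖ Ω(h)) ≤ |Z_k|`, `N³ ≤ |T₁^{(k)}|` give
`VacuumWhole P (C·K₀(32,6)) (rawConstR (C·K₀(32,6)) R₁ g κ₀)`. [cite: Balaban1985UV3, (59) p.270 + (25) p.262 + p.265] -/
theorem vacuumWhole_torus (N : ℕ) [NeZero N] (P : StepPieces T k) {κ C : ℝ} {Cfg : Type}
    (hκ : kappa₀ (4 * 2 ^ 3) (2 * 3) + 1 ≤ κ)
    (act : (TreeLengthTorus.tsys 3 N).Dom → Cfg → ℝ) (one : Cfg) (hC : 0 ≤ C)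
    (h25 : Bound25Printed ⟨(TreeLengthTorus.tsys 3 N).Dom, Cfg, (TreeLengthTorus.tsys 3 N).dj, act⟩ (T.g k) κ C)
    (Ω : T.Hist (k + 1) → Finset (TreeLengthTorus.tcubeSys 3 N).Cube)
    (g L ε κ₀ r₀ R₁ : ℝ) (hg : 0 < g) (hL : 0 < L) (hε : 0 < ε) (hκ₀ : 0 < κ₀) (hr₀ : 1 ≤ r₀)
    (hR₁ : 6 + 2 * κ₀ ≤ R₁) (hgk : T.g k = gRun g L ε k) (hgk1 : T.g k ≤ 1)
    (hrem : P.rem = (L ^ k * ε) ^ (3 + κ₀) * T.sites k)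
    (hPprT : P.PprT = ∑ X : (TreeLengthTorus.tsys 3 N).Dom, act X one)
    (hPpr1 : ∀ h, P.Ppr1 h = ∑ X ∈ (Finset.univ.filter
        (fun X : (TreeLengthTorus.tsys 3 N).Dom => (TreeLengthTorus.tcubeSys 3 N).cubes X ⊆ Ω h)).filter
        (fun X => (TreeLengthTorus.tsys 3 N).dj X < R₁ * rFun r₀ (T.g k)), act X one)
    (hZ : ∀ h, ((Finset.univ \ Ω h).card : ℝ) ≤ P.Zvol h) (hblocks : ((N : ℝ) ^ 3) ≤ T.sites k) :
    VacuumWhole P (C * K₀ (4 * 2 ^ 3) (2 * 3)) (rawConstR (C * K₀ (4 * 2 ^ 3) (2 * 3)) R₁ g κ₀) := by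
  have hcard : (Fintype.card (TreeLengthTorus.tcubeSys 3 N).Cube : ℝ) ≤ T.sites k := by
    rw [TreeLengthTorus.card_tcube]; push_cast; exact hblocks
  exact vacuumWhole_of_bound25 P (TreeLengthTorus.tcubeSys 3 N) (TreeLengthTorus.tdegreeLE 3 N)
    (TreeLengthTorus.tvolumeLeaf 3 N) hκ act one hC h25 Ω g L ε κ₀ r₀ R₁ hg hL hε hκ₀ hr₀ hR₁ hgk hgk1 hrem hPprT
    hPpr1 hZ hcard

end Vacuum

/-! ## §2 The remainder booking: `RmSucc` for a run with `Rm k = c·Σ_{j<k} rem_j` -/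

section Booking

variable {T : TowerRun} {k : ℕ}

/-- **Leaf `RmSucc` of `B10SectAGathering.StepLeaves`** — the TYPE is literally the leaf — for a run that BOOKS its
remainder coefficient as the partial sum `Rm j = c · Σ_{i<j} rem_i` ((41) p. 266 «+ Σ_{j=0}^{k−1}
O((Lʲε)^{3+κ₀})|T₁^{(j)}|»; the shape prover seat p3 gives `run3`, lane STATUS P3-F1: `Rm k := rstar · Σ_{j<k}
(g_j²)^{3+κ₀}|T₁^{(j)}|`): with `P.rem = rem_k`, `RmSucc P CR` for every `CR ≤ c` (LQB `B10Assembly.rmSucc_of_booking`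
+ `RmSucc.mono`).  The content is only WHICH `c` is admissible: `c ≥ max C₁ C₁' + C₂ + C₃ + C₄`, the gathered
constants of `Cumulant58`/`CumulantLower`/`Repr33_60`/`VacuumWhole`/`Decomp35_61` (`StepLeaves.rmSucc`; with the raw
leaves, `B10Assembly.rstarRawR`). [cite: Balaban1985UV3, (41) p.266] -/
theorem rmSucc_of_partialSum (P : StepPieces T k) (remk : ℕ → ℝ) (c CR : ℝ)
    (hRm : ∀ j, T.Rm j = c * ∑ i ∈ Finset.range j, remk i) (hrem : P.rem = remk k) (hCR : CR ≤ c) :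
    RmSucc P CR := by
  have hb : T.Rm (k + 1) = T.Rm k + c * P.rem := by
    rw [hRm (k + 1), hRm k, Finset.sum_range_succ, hrem]; ring
  exact (rmSucc_of_booking P hb).1.mono hCR


/-- **Leaf `RmSucc` for the spine's LITERAL booking** (typer-1 `SectB.TowerObjects.Rm k = Σ_{j<k} rcoef j ·
(L^jε)^{3+κ₀}·|T₁^{(j)}|`, (41) p. 266 «Σ_{j=0}^{k−1} O((Lʲε)^{3+κ₀})|T₁^{(j)}|» with the O(·)-constants `rcoef j`
explicit): if `Rm j = Σ_{i<j} r i` for any summands `r` and the k-th summand dominates `CR·rem_k`, then `RmSucc P CR`.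
(`r k = rcoef k·(L^kε)^{3+κ₀}|T₁^{(k)}|`; with `rem_k = (L^kε)^{3+κ₀}|T₁^{(k)}|` the hypothesis is `CR ≤ rcoef k`, in
p3's normalised units it is his `remainder_sum_literal_eq`.) [cite: Balaban1985UV3, (41) p.266] -/
theorem rmSucc_of_sum_booking (P : StepPieces T k) (r : ℕ → ℝ) (CR : ℝ)
    (hRm : ∀ j, T.Rm j = ∑ i ∈ Finset.range j, r i) (hstep : CR * P.rem ≤ r k) : RmSucc P CR := by
  unfold RmSucc
  rw [hRm (k + 1), hRm k, Finset.sum_range_succ]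
  linarith

end Booking

end Summit.QuantumFields.Balaban3D.Proofs.VacuumAndBooking

end
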